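import Mathlib
import HarnessLib
import Summits.Ventures.LatticeQCDFlow.Scaling.IMHHoldingTimeESS
import Summits.Ventures.LatticeQCDFlow.Scaling.WilsonIdentityFlowHoldingTime
import Summits.Ventures.LatticeQCDFlow.Scaling.TiltAcceptanceCouplingMonotone
import Summits.Ventures.LatticeQCDFlow.Scaling.U1IdentityFlowVolumeLaw

/-!
# LatticeQCDFlow / Scaling — the equilibrium MEAN HOLDING TIME `E_π[1/a]` of the untrained
# (identity-flow) exact sampler is NON-DECREASING in the coupling `β ≥ 0`: every tilt family,
# every Wilson lattice gauge theory and reference law, the factorised 2-d U(1) model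

HONEST FRAMING: exact (Metropolis-corrected) sampling algorithms for lattice gauge theory;
figures of merit are autocorrelation/cost numbers at stated couplings and volumes; no
continuum-physics claim.

Venture `LatticeQCDFlow` (cell pub-lqcd), topic `Scaling`; FANOUT row 3 (`s0-u1-a`, S0-B
implementation A, GEN-17).  NEW WORK of the cell, not a published result; NO definition is
introduced.  Objects of row 2's `Exactness/IMHRejectionCurve` (the rejection curve
`λ = rejCurve μ w q`; `1 − λ(b(x))` is the probability that the exact flow-MCMC chain sitting at `x`
accepts its next proposal) and row 3's `Scaling/IMHHoldingTimeESS` (the equilibrium mean holding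
time `E_π[1/a] = ∫ w/(1 − λ(b)) dμ / Z ∈ [1/ESS, 2/ESS]`, `= τ_int + ½` of every weight-blind
observable), both imported.  For the UNTRAINED sampler of a tilt family — proposals from `cν`
(constant density `c`, `∫ c dν = 1`), target `e^{βT}ν/Z(β)` — row 3 typed the closed-form bracket
(`Scaling/WilsonIdentityFlowHoldingTime`, `U1IdentityFlowHoldingTime`) and GEN-16 proved the
bracket's ends `1/ESS = Z(2β)/Z(β)²` monotone in `β`; this file proves that the holding time ITSELF
is monotone, by the Chebyshev argument of `Scaling/TiltAcceptanceCouplingMonotone` (imported) in its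
comonotone form.

* §1 `one_sub_rejCurve_tilt_eq` — the per-state acceptance is the overlap kernel:
  `1 − λ_β(e^{βT(x)}/c) = Φ_β(T x) = ∫ c·min(1, e^{β(T − T x)}) dν`; `tiltOverlap_pos` (`Φ > 0`);
  `integrable_exp_mul_div_overlap` (`e^{βT}/Φ_β(T) ∈ L¹`, from `integrable_holdingTime` with
  `W₂ = ∫ e^{2βT}/c`), `integrable_exp_mul_div_overlap'` (the mixed integrand, dominated);
  **`tiltIMH_holdingTime_monotoneOn`** — `β ↦ (∫ e^{βT}/(1 − λ_β) dν)/∫ e^{βT} dν = E_{π_β}[1/Φ_β(T)]`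
  is NON-DECREASING on `[0, ∞)`: `1/Φ_β(t)` is non-decreasing in `β` and in `t`, and `π_{β′}` is the
  increasing reweighting `∝ e^{(β′−β)T}π_β`, so
  `E_{π_β}[1/Φ_β(T)] ≤ E_{π_{β′}}[1/Φ_β(T)] ≤ E_{π_{β′}}[1/Φ_{β′}(T)]`
  (`integral_mul_integral_le_integral_mul_mul_of_comonotone`).  Auxiliaries:
  `div_max_self_eq_min_one_div`, `integrable_const_of_integral_eq_one`,
  `measure_univ_pos_of_integral_const`, `integrable_const_mul_exp_mul`.
* §2 WILSON theory, every compact `G`, continuous `ρ`, `d`, `L`, reference probability law `μ`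
  (`c = 1`, `T = −S`): **`wilsonIdentityFlow_holdingTime_monotoneOn`** — the holding time of
  `wilsonIdentityFlow_holdingTime_mem_Icc` is non-decreasing on `[0, ∞)`; product-Haar /
  `partitionFunction` form **`wilsonIdentityFlow_holdingTime_monotoneOn_haar`**.
* §3 the FACTORISED 2-d U(1) model, every finite plaquette set: `rejCurve_div_const` (scale
  invariance of `λ`), `u1IdentityFlow_holdingTime_eq_ratio`,
  **`u1IdentityFlow_holdingTime_monotoneOn`** — the holding time of
  `u1IdentityFlow_holdingTime_mem_Icc` is non-decreasing on `[0, ∞)`.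

Reading (value-free; no number of ours is computed or implied): along a coupling ray the untrained
exact sampler spends monotonically MORE proposals per accepted move — equivalently the integrated
autocorrelation time of every weight-blind observable is non-decreasing in `β` — not merely its
`[1/ESS, 2/ESS]` bracket.  NOT CLAIMED: strict increase; the law on `β ≤ 0` (apply §1 to `−T`);
trained flows; any value at the cell's `(β, L)`; nothing re-scored, SEALED.md untouched.
-/

noncomputable section

namespace Summit.Ventures.LatticeQCDFlow.Theory2

open MeasureTheory Real Set
open Summit.Ventures.LatticeQCDFlow.Exactness

/-! ## §1 General tilt families with a constant proposal density -/

section Tilt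

variable {Ω : Type*} [MeasurableSpace Ω] {ν : Measure Ω} [SFinite ν] {c : ℝ} {T : Ω → ℝ}

/-- `a / max a v = min 1 (a / v)` for `a, v > 0`. [folklore] -/
theorem div_max_self_eq_min_one_div {a v : ℝ} (ha : 0 < a) (hv : 0 < v) :
    a / max a v = min 1 (a / v) := by
  rcases le_total a v with h | h
  · rw [max_eq_right h, min_eq_right ((div_le_one hv).2 h)]
  · rw [max_eq_left h, div_self ha.ne', min_eq_left ((one_le_div hv).2 h)]

variable (hc : 0 < c) (hc1 : ∫ _x, c ∂ν = 1) (hTm : Measurable T)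
  (hint : ∀ γ : ℝ, 0 ≤ γ → Integrable (fun x => Real.exp (γ * T x)) ν)
include hc hc1 hTm hint

omit [SFinite ν] hc hc1 hTm in
/-- Exponential moments in the weighted form of `Scaling/TiltAcceptanceCouplingMonotone`. [folklore] -/
theorem integrable_const_mul_exp_mul {γ : ℝ} (hγ : 0 ≤ γ) :
    Integrable (fun x => c * Real.exp (γ * T x)) ν := (hint γ hγ).const_mul c

omit [SFinite ν] hc hTm hint in
/-- `ν ≠ 0` in the form `0 < ν univ`. [folklore] -/
theorem measure_univ_pos_of_integral_const : 0 < ν univ := by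
  rw [Measure.measure_univ_pos]
  intro h
  rw [h, integral_zero_measure] at hc1
  exact zero_ne_one hc1

omit [SFinite ν] hc hTm hint in
/-- The constant proposal density is integrable (its integral is `1 ≠ 0`). [folklore] -/
theorem integrable_const_of_integral_eq_one : Integrable (fun _ : Ω => c) ν := by
  by_contra h
  rw [integral_undef h] at hc1
  exact zero_ne_one hc1

omit [SFinite ν] hint in
/-- **The per-state acceptance of the untrained sampler is the overlap kernel**: with target weight
`w = e^{βT}` and constant model density `c` (`∫ c dν = 1`),
`1 − λ(w(x)/c) = Φ_β(T x) = ∫ c·min(1, e^{β(T − T x)}) dν` (row 2's rejection curve `λ = rejCurve`).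
[ours] -/
theorem one_sub_rejCurve_tilt_eq (β : ℝ) (x : Ω) :
    1 - rejCurve ν (fun z => Real.exp (β * T z)) (fun _ => c) (Real.exp (β * T x) / c)
      = ∫ z, c * min 1 (Real.exp (β * (T z - T x))) ∂ν := by
  have hw0 : ∀ z, 0 < Real.exp (β * T z) := fun z => Real.exp_pos _
  have hwm : Measurable fun z => Real.exp (β * T z) := Real.measurable_exp.comp (hTm.const_mul β)
  rw [one_sub_rejCurve_eq_integral_inv_max hw0 hwm (fun _ => hc) measurable_const
    (integrable_const_of_integral_eq_one hc1) hc1 (div_pos (hw0 x) hc)]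
  refine integral_congr_ae (ae_of_all _ fun z => ?_)
  simp only
  rw [max_div_div_right hc.le, div_div_eq_mul_div, mul_comm, mul_div_assoc,
    div_max_self_eq_min_one_div (hw0 z) (hw0 x), ← Real.exp_sub, ← mul_sub]

omit [SFinite ν] hint in
/-- `Φ_β(t) > 0`. [folklore] -/
theorem tiltOverlap_pos (β t : ℝ) : 0 < ∫ z, c * min 1 (Real.exp (β * (T z - t))) ∂ν := by
  have hpos : ∀ z, 0 < c * min 1 (Real.exp (β * (T z - t))) := fun z =>
    mul_pos hc (lt_min one_pos (Real.exp_pos _))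
  rw [integral_pos_iff_support_of_nonneg (fun z => (hpos z).le)
    (integrable_mul_min_one_exp (fun _ => hc.le) measurable_const hTm
      (integrable_const_of_integral_eq_one hc1) β t),
    show Function.support (fun z => c * min 1 (Real.exp (β * (T z - t)))) = univ from
      eq_univ_of_forall fun z => (hpos z).ne']
  exact measure_univ_pos_of_integral_const hc1

/-- **The equilibrium holding-time integrand is integrable**: `e^{βT}/Φ_β(T) ∈ L¹(ν)` (row 3's
`integrable_holdingTime` with `W₂ = ∫ e^{2βT}/c < ∞`). [ours] -/
theorem integrable_exp_mul_div_overlap {β : ℝ} (hβ : 0 ≤ β) :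
    Integrable (fun x => Real.exp (β * T x)
      / ∫ z, c * min 1 (Real.exp (β * (T z - T x))) ∂ν) ν := by
  have hw0 : ∀ z, 0 < Real.exp (β * T z) := fun z => Real.exp_pos _
  have hwm : Measurable fun z => Real.exp (β * T z) := Real.measurable_exp.comp (hTm.const_mul β)
  have hW₂ : Integrable (fun x => Real.exp (β * T x) / c * Real.exp (β * T x)) ν := by
    have e : (fun x => Real.exp (β * T x) / c * Real.exp (β * T x))
        = fun x => c⁻¹ * Real.exp ((2 * β) * T x) := by
      funext x
      rw [div_mul_eq_mul_div, ← Real.exp_add, show β * T x + β * T x = (2 * β) * T x by ring]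
      ring
    rw [e]; exact (hint _ (by linarith)).const_mul _
  have h := integrable_holdingTime hw0 hwm (hint β hβ) (fun _ => hc) measurable_const
    (integrable_const_of_integral_eq_one hc1) hc1 hW₂
  refine h.congr (ae_of_all _ fun x => ?_)
  simp only
  rw [one_sub_rejCurve_tilt_eq hc hc1 hTm β x]

/-- The mixed integrand `e^{β′T}/Φ_β(T)` (`0 ≤ β ≤ β′`) is integrable, dominated by
`e^{β′T}/Φ_{β′}(T)`. [ours] -/
theorem integrable_exp_mul_div_overlap' {β β' : ℝ} (hβ : 0 ≤ β) (hββ' : β ≤ β') :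
    Integrable (fun x => Real.exp (β' * T x)
      / ∫ z, c * min 1 (Real.exp (β * (T z - T x))) ∂ν) ν := by
  have hΦm : Measurable fun x => ∫ z, c * min 1 (Real.exp (β * (T z - T x))) ∂ν :=
    (integral_mul_min_one_exp_antitone (fun _ => hc.le) measurable_const hTm
      (integrable_const_of_integral_eq_one hc1) hβ).measurable.comp hTm
  refine (integrable_exp_mul_div_overlap hc hc1 hTm hint (hβ.trans hββ')).mono'
    ((Real.measurable_exp.comp (hTm.const_mul β')).div hΦm).aestronglyMeasurable
    (ae_of_all _ fun x => ?_)
  have h1 := tiltOverlap_pos hc hc1 hTm β (T x)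
  have h2 := tiltOverlap_pos hc hc1 hTm β' (T x)
  rw [Real.norm_eq_abs, abs_of_nonneg (div_nonneg (Real.exp_pos _).le h1.le)]
  exact div_le_div_of_nonneg_left (Real.exp_pos _).le h2
    (integral_mul_min_one_exp_antitone_param (fun _ => hc.le) measurable_const hTm
      (integrable_const_of_integral_eq_one hc1) hβ hββ' _)

/-- **THE MEAN HOLDING TIME OF THE UNTRAINED SAMPLER IS NON-DECREASING IN THE COUPLING.**  For a
base measure `ν`, a constant proposal density `c` (`∫ c dν = 1`) and a measurable statistic `T`
with the exponential moments `∫ e^{γT} dν < ∞` for `γ ≥ 0`, the equilibrium mean holding time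
`E_{π_β}[1/a] = (∫ e^{βT}/(1 − λ_β(e^{βT}/c)) dν)/∫ e^{βT} dν` of the exact sampler proposing from
`cν` against `e^{βT}ν/Z(β)` — the mean number of proposals spent per move, `τ_int + ½` of every
weight-blind observable (`Scaling/IMHHoldingTimeESS`) — is a NON-DECREASING function of `β` on
`[0, ∞)`.  Proof: `1/Φ_β(T)` increases with `β` and is a monotone function of `T`, and `π_{β′}` is an
increasing exponential reweighting of `π_β` (Chebyshev's integral inequality, comonotone form).
[ours] -/
theorem tiltIMH_holdingTime_monotoneOn :
    MonotoneOn (fun β : ℝ =>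
      (∫ x, Real.exp (β * T x) / (1 - rejCurve ν (fun z => Real.exp (β * T z)) (fun _ => c)
          (Real.exp (β * T x) / c)) ∂ν)
        / ∫ x, Real.exp (β * T x) ∂ν) (Ici 0) := by
  intro β hβ β' hβ' hββ'
  have hβ0 : (0 : ℝ) ≤ β := hβ
  have hβ'0 : (0 : ℝ) ≤ β' := hβ'
  have hqi : Integrable (fun _ : Ω => c) ν := integrable_const_of_integral_eq_one hc1
  set Φ : ℝ → ℝ → ℝ := fun γ t => ∫ z, c * min 1 (Real.exp (γ * (T z - t))) ∂ν with hΦ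
  have hM : ∀ γ, 0 ≤ γ → 0 < ∫ x, Real.exp (γ * T x) ∂ν := fun γ hγ => by
    rw [integral_pos_iff_support_of_nonneg (fun x => (Real.exp_pos _).le) (hint γ hγ),
      show Function.support (fun x => Real.exp (γ * T x)) = univ from
        eq_univ_of_forall fun x => (Real.exp_pos _).ne']
    exact measure_univ_pos_of_integral_const hc1
  simp only [one_sub_rejCurve_tilt_eq hc hc1 hTm]
  show (∫ x, Real.exp (β * T x) / Φ β (T x) ∂ν) / ∫ x, Real.exp (β * T x) ∂ν
    ≤ (∫ x, Real.exp (β' * T x) / Φ β' (T x) ∂ν) / ∫ x, Real.exp (β' * T x) ∂ν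
  have hΦpos : ∀ γ t, 0 < Φ γ t := tiltOverlap_pos hc hc1 hTm
  -- Step 1 (Chebyshev, comonotone): `E_{π_β}[1/Φ_β(T)] ≤ E_{π_β'}[1/Φ_β(T)]`
  have hFG := comonotone_of_monotone_monotone (T := T)
    (f := fun t => Real.exp ((β' - β) * t)) (g := fun t => (Φ β t)⁻¹)
    (fun s t hst => Real.exp_le_exp.2 (mul_le_mul_of_nonneg_left hst (sub_nonneg.2 hββ')))
    (fun s t hst => inv_anti₀ (hΦpos β t)
      (integral_mul_min_one_exp_antitone (fun _ => hc.le) measurable_const hTm hqi hβ0 hst))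
  have ekF : ∀ x, Real.exp (β * T x) * Real.exp ((β' - β) * T x) = Real.exp (β' * T x) := by
    intro x; rw [← Real.exp_add]; ring_nf
  have hk : ∀ x, 0 ≤ Real.exp (β * T x) := fun x => (Real.exp_pos _).le
  have hkF : Integrable (fun x => Real.exp (β * T x) * Real.exp ((β' - β) * T x)) ν := by
    simp_rw [ekF]; exact hint β' hβ'0
  have hkG : Integrable (fun x => Real.exp (β * T x) * (Φ β (T x))⁻¹) ν := by
    simp_rw [← div_eq_mul_inv]; exact integrable_exp_mul_div_overlap hc hc1 hTm hint hβ0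
  have hkFG : Integrable (fun x => Real.exp (β * T x)
      * (Real.exp ((β' - β) * T x) * (Φ β (T x))⁻¹)) ν := by
    refine (integrable_exp_mul_div_overlap' hc hc1 hTm hint hβ0 hββ').congr
      (ae_of_all _ fun x => ?_)
    simp only
    rw [← mul_assoc, ekF, div_eq_mul_inv]
  have cheb := integral_mul_integral_le_integral_mul_mul_of_comonotone hk hFG (hint β hβ0) hkF hkG
    hkFG
  have e1 : ∫ x, Real.exp (β * T x) * Real.exp ((β' - β) * T x) ∂ν = ∫ x, Real.exp (β' * T x) ∂ν :=
    integral_congr_ae (ae_of_all _ fun x => ekF x)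
  have e2 : ∫ x, Real.exp (β * T x) * (Φ β (T x))⁻¹ ∂ν = ∫ x, Real.exp (β * T x) / Φ β (T x) ∂ν :=
    integral_congr_ae (ae_of_all _ fun x => by simp only; rw [div_eq_mul_inv])
  have e3 : ∫ x, Real.exp (β * T x) * (Real.exp ((β' - β) * T x) * (Φ β (T x))⁻¹) ∂ν
      = ∫ x, Real.exp (β' * T x) / Φ β (T x) ∂ν :=
    integral_congr_ae (ae_of_all _ fun x => by simp only; rw [← mul_assoc, ekF, div_eq_mul_inv])
  rw [e1, e2, e3] at cheb
  -- Step 2: `1/Φ_β ≤ 1/Φ_β'` pointwise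
  have step2 : ∫ x, Real.exp (β' * T x) / Φ β (T x) ∂ν
      ≤ ∫ x, Real.exp (β' * T x) / Φ β' (T x) ∂ν := by
    refine integral_mono (integrable_exp_mul_div_overlap' hc hc1 hTm hint hβ0 hββ')
      (integrable_exp_mul_div_overlap hc hc1 hTm hint hβ'0) fun x => ?_
    exact div_le_div_of_nonneg_left (Real.exp_pos _).le (hΦpos β' (T x))
      (integral_mul_min_one_exp_antitone_param (fun _ => hc.le) measurable_const hTm hqi hβ0
        hββ' _)
  rw [div_le_div_iff₀ (hM β hβ0) (hM β' hβ'0)]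
  calc (∫ x, Real.exp (β * T x) / Φ β (T x) ∂ν) * ∫ x, Real.exp (β' * T x) ∂ν
      = (∫ x, Real.exp (β' * T x) ∂ν) * ∫ x, Real.exp (β * T x) / Φ β (T x) ∂ν := mul_comm _ _
    _ ≤ (∫ x, Real.exp (β' * T x) / Φ β (T x) ∂ν) * ∫ x, Real.exp (β * T x) ∂ν := cheb
    _ ≤ (∫ x, Real.exp (β' * T x) / Φ β' (T x) ∂ν) * ∫ x, Real.exp (β * T x) ∂ν :=
        mul_le_mul_of_nonneg_right step2 (hM β hβ0).le

end Tilt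

/-! ## §2 Wilson lattice gauge theory: the untrained sampler's mean holding time is non-decreasing
in `β ≥ 0` -/

section Wilson

open Literature.MathematicalPhysics.QuantumFieldTheory

variable {d L N : ℕ} [NeZero L] {G : Type*} [Group G] [TopologicalSpace G] [IsTopologicalGroup G]
  [CompactSpace G] [MeasurableSpace G] [BorelSpace G] (ρ : G →* Matrix (Fin N) (Fin N) ℂ)
  (μ : Measure (GaugeConfig d L G)) [IsProbabilityMeasure μ]

/-- **THE UNTRAINED WILSON SAMPLER'S MEAN HOLDING TIME `E_π[1/a]` IS NON-DECREASING IN `β ≥ 0`**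
— every compact `G`, continuous `ρ`, `d`, `L`, reference probability law `μ` (the holding time of
`Scaling/WilsonIdentityFlowHoldingTime.wilsonIdentityFlow_holdingTime_mem_Icc`, which pins it in
`[1/ESS, 2/ESS]`). [ours] -/
theorem wilsonIdentityFlow_holdingTime_monotoneOn (hρ : Continuous ρ) :
    MonotoneOn (fun β : ℝ => (∫ U, Real.exp (-β * wilsonAction ρ U)
        / (1 - rejCurve μ (fun V => Real.exp (-β * wilsonAction ρ V)) (fun _ => (1 : ℝ))
            (Real.exp (-β * wilsonAction ρ U) / 1)) ∂μ)
        / ∫ V, Real.exp (-β * wilsonAction ρ V) ∂μ) (Ici 0) := by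
  have hint : ∀ γ : ℝ, Integrable (fun U : GaugeConfig d L G =>
      Real.exp (γ * -wilsonAction ρ U)) μ := fun γ => by
    simpa only [mul_neg, neg_mul] using integrable_exp_mul_wilsonAction ρ hρ (-γ) μ
  have hc1 : ∫ _U : GaugeConfig d L G, (1 : ℝ) ∂μ = 1 := by
    rw [integral_const, probReal_univ, one_smul]
  have h := tiltIMH_holdingTime_monotoneOn (ν := μ) (c := (1 : ℝ)) (T := fun U => -wilsonAction ρ U)
    one_pos hc1 (WilsonRP.measurable_wilsonAction ρ hρ).neg (fun γ _ => hint γ)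
  intro β hβ β' hβ' hββ'
  have e : ∀ γ : ℝ, (fun V : GaugeConfig d L G => Real.exp (-γ * wilsonAction ρ V))
      = fun V => Real.exp (γ * -wilsonAction ρ V) := fun γ => by
    funext V; rw [mul_neg, neg_mul]
  have h' := h hβ hβ' hββ'
  simp only [e, mul_neg, ← neg_mul] at h' ⊢
  exact h'

/-- Product-Haar proposals (the cell's identity flow; `Z = partitionFunction ρ β`): the mean holding
time is non-decreasing on `[0, ∞)`. [ours] -/
theorem wilsonIdentityFlow_holdingTime_monotoneOn_haar (hρ : Continuous ρ) :
    MonotoneOn (fun β : ℝ => (∫ U, Real.exp (-β * wilsonAction ρ U)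
        / (1 - rejCurve (Measure.pi fun _ : Edge d L => haarProbability G)
            (fun V => Real.exp (-β * wilsonAction ρ V)) (fun _ => (1 : ℝ))
            (Real.exp (-β * wilsonAction ρ U) / 1))
          ∂(Measure.pi fun _ : Edge d L => haarProbability G))
        / (partitionFunction (d := d) (L := L) ρ β).toReal) (Ici 0) := by
  simp_rw [partitionFunction_toReal_eq_integral ρ hρ]
  exact wilsonIdentityFlow_holdingTime_monotoneOn ρ _ hρ

end Wilson

/-! ## §3 The factorised 2-d U(1) model: the mean holding time is non-decreasing in `β ≥ 0` -/

section U1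

open Finset
open Summit.Ventures.LatticeQCDFlow.Scoring (onePlaquetteZ onePlaquetteZ_pos)

/-- **Scale invariance of the rejection curve**: dividing the target weight and the level by the
same constant leaves `λ` unchanged (only the ratio `b/v` enters). [ours] -/
theorem rejCurve_div_const {X : Type*} [MeasurableSpace X] (μ : Measure X) (w q : X → ℝ) {K : ℝ}
    (hK : K ≠ 0) (v : ℝ) :
    rejCurve μ (fun z => w z / K) q (v / K) = rejCurve μ w q v := by
  unfold rejCurve
  refine integral_congr_ae (ae_of_all _ fun z => ?_)
  simp only
  rw [div_div_eq_mul_div, div_right_comm (w z), div_mul_cancel₀ _ hK]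

variable {ι : Type*} [Fintype ι]

/-- The U(1) holding-time integral of `Scaling/U1IdentityFlowHoldingTime` in the tilt form of §1
(`ν = Lebesgue^{⊗V}` on `(0, 2π]^V`, `c = (2π)^{−V}`, `T = Σᵢ cos θᵢ`). [ours] -/
theorem u1IdentityFlow_holdingTime_eq_ratio (β : ℝ) :
    ∫ x, (∏ i : ι, Real.exp (β * Real.cos (x i)) / onePlaquetteZ β)
        / (1 - rejCurve (Measure.pi fun _ : ι => volume.restrict (Ioc (0 : ℝ) (2 * π)))
            (fun x : ι → ℝ => ∏ i, Real.exp (β * Real.cos (x i)) / onePlaquetteZ β)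
            (fun _ : ι → ℝ => ∏ _i : ι, (1 / (2 * π) : ℝ))
            ((∏ i, Real.exp (β * Real.cos (x i)) / onePlaquetteZ β) / ∏ _i : ι, (1 / (2 * π) : ℝ)))
        ∂(Measure.pi fun _ : ι => volume.restrict (Ioc (0 : ℝ) (2 * π)))
      = (∫ x, Real.exp (β * ∑ i, Real.cos (x i))
          / (1 - rejCurve (Measure.pi fun _ : ι => volume.restrict (Ioc (0 : ℝ) (2 * π)))
              (fun z : ι → ℝ => Real.exp (β * ∑ i, Real.cos (z i)))
              (fun _ : ι → ℝ => ∏ _i : ι, (1 / (2 * π) : ℝ))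
              (Real.exp (β * ∑ i, Real.cos (x i)) / ∏ _i : ι, (1 / (2 * π) : ℝ)))
          ∂(Measure.pi fun _ : ι => volume.restrict (Ioc (0 : ℝ) (2 * π))))
        / ∫ x, Real.exp (β * ∑ i, Real.cos (x i))
          ∂(Measure.pi fun _ : ι => volume.restrict (Ioc (0 : ℝ) (2 * π))) := by
  set ν : Measure ℝ := volume.restrict (Ioc (0 : ℝ) (2 * π)) with hν
  set Zv : ℝ := onePlaquetteZ β ^ Fintype.card ι with hZv
  have hZv0 : Zv ≠ 0 := (pow_pos (onePlaquetteZ_pos β) _).ne'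
  have hP : ∀ x : ι → ℝ, ∏ i, Real.exp (β * Real.cos (x i)) / onePlaquetteZ β
      = Real.exp (β * ∑ i, Real.cos (x i)) / Zv := by
    intro x
    rw [prod_div_distrib, prod_const, card_univ, mul_sum, Real.exp_sum]
  have hM : ∫ x, Real.exp (β * ∑ i, Real.cos (x i)) ∂(Measure.pi fun _ : ι => ν) = Zv := by
    have e : ∀ x : ι → ℝ, Real.exp (β * ∑ i, Real.cos (x i)) = ∏ i, Real.exp (β * Real.cos (x i)) :=
      fun x => by rw [mul_sum, Real.exp_sum]
    simp_rw [e]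
    rw [integral_fintype_prod_eq_prod (μ := fun _ : ι => ν)
      (fun (_ : ι) (θ : ℝ) => Real.exp (β * Real.cos θ)), prod_const, card_univ, hν,
      integral_Ioc_exp_mul_cos]
  simp_rw [hP]
  rw [hM]
  simp_rw [div_right_comm _ Zv, rejCurve_div_const _ _ _ hZv0, integral_div]

/-- **THE UNTRAINED 2-d U(1) SAMPLER'S MEAN HOLDING TIME IS NON-DECREASING IN `β ≥ 0`** (the holding
time of `Scaling/U1IdentityFlowHoldingTime.u1IdentityFlow_holdingTime_mem_Icc`, pinned there in
`[(I₀(2β)/I₀(β)²)^V, 2(I₀(2β)/I₀(β)²)^V]`), every finite plaquette set. [ours] -/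
theorem u1IdentityFlow_holdingTime_monotoneOn :
    MonotoneOn (fun β : ℝ => ∫ x, (∏ i : ι, Real.exp (β * Real.cos (x i)) / onePlaquetteZ β)
        / (1 - rejCurve (Measure.pi fun _ : ι => volume.restrict (Ioc (0 : ℝ) (2 * π)))
            (fun x : ι → ℝ => ∏ i, Real.exp (β * Real.cos (x i)) / onePlaquetteZ β)
            (fun _ : ι → ℝ => ∏ _i : ι, (1 / (2 * π) : ℝ))
            ((∏ i, Real.exp (β * Real.cos (x i)) / onePlaquetteZ β) / ∏ _i : ι, (1 / (2 * π) : ℝ)))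
        ∂(Measure.pi fun _ : ι => volume.restrict (Ioc (0 : ℝ) (2 * π)))) (Ici 0) := by
  set ν : Measure ℝ := volume.restrict (Ioc (0 : ℝ) (2 * π)) with hν
  have hc : 0 < ∏ _i : ι, (1 / (2 * π) : ℝ) := prod_pos fun _ _ => by positivity
  have hc1 : ∫ _x : ι → ℝ, (∏ _i : ι, (1 / (2 * π) : ℝ)) ∂(Measure.pi fun _ : ι => ν) = 1 := by
    rw [show (fun _x : ι → ℝ => ∏ _i : ι, (1 / (2 * π) : ℝ))
        = fun x : ι → ℝ => ∏ i : ι, (fun (_ : ι) (_ : ℝ) => (1 / (2 * π) : ℝ)) i (x i) from rfl,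
      integral_fintype_prod_eq_prod (μ := fun _ : ι => ν) (fun (_ : ι) (_ : ℝ) => (1 / (2 * π) : ℝ)),
      prod_eq_one fun i _ => ?_]
    rw [hν]; exact integral_u1Haar
  have hTm : Measurable fun x : ι → ℝ => ∑ i, Real.cos (x i) :=
    Finset.measurable_sum _ fun i _ => Real.measurable_cos.comp (measurable_pi_apply i)
  have hint : ∀ γ : ℝ, Integrable (fun x : ι → ℝ => Real.exp (γ * ∑ i, Real.cos (x i)))
      (Measure.pi fun _ : ι => ν) := fun γ => by
    have h1 : Integrable (fun x : ι → ℝ => ∏ i, Real.exp (γ * Real.cos (x i))) (Measure.pi fun _ => ν) :=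
      Integrable.fintype_prod_dep (μ := fun _ : ι => ν) fun _ => integrableOn_exp_mul_cos γ
    exact h1.congr (ae_of_all _ fun x => by simp only; rw [mul_sum, Real.exp_sum])
  have h := tiltIMH_holdingTime_monotoneOn hc hc1 hTm (fun γ _ => hint γ)
  intro β hβ β' hβ' hββ'
  simp only [hν, u1IdentityFlow_holdingTime_eq_ratio]
  exact h hβ hβ' hββ'

end U1

end Summit.Ventures.LatticeQCDFlow.Theory2
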